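import Literature.AlgebraicGeometry.HodgeTheory.UnitaryHodgeGroupPowersHodgeClasses
import Literature.AlgebraicGeometry.Motives.HodgeThetaSubalgebraUnitaryTwoThree
import HarnessLib

/-!
# The unitary socket discharged on Ribet type `(2,3)`: `Lie Hg = 𝔲_k` for an abelian FIVEFOLD with `End⁰ = k` imaginary quadratic acting with multiplicities `(3,2)` — UNCONDITIONAL (Moonen–Zarhin 1999 (2.4), (2.7); Ribet 1983 Thm. 3 at the coprime pair `(2,3)`)

Family `hodge`, layer `Literature/AlgebraicGeometry/HodgeTheory`; cell `pub-hodgeav-hg6` (row 2 «base of HC ladder», TABLE X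
Weil PRODUCT row 17 `E_k × Y₅^{(3,2)}`: the FACTOR input «`Lie Hg(Y₅) = 𝔲(3,2)`» for every member with `End⁰(Y₅) = k`;
nothing here proves HC, HC_AV or HC_CM). UNCONDITIONAL; theorems only, no definition, no named fact, no instance, no
`sorry`; nothing of `RibetTypeTwoThreePowersHodgeClasses` (the `B = D` consequences on all powers, already in the tree) is
restated.  This is the `(2,3)` twin of the `(m,1)` adapter `UnitaryHodgeGroupOfRibetTypeOne` and of §1 of the `(4,2)`
adapter `UnitaryHodgeGroupOfRibetTypeFourTwo`: the tree's Lie theorem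
`UnitaryThetaTwoThree.mem_spanC_of_commute_of_skew` (`Motives/HodgeThetaSubalgebraUnitaryTwoThree`, resting on the
classification-free complex core `UnitaryThetaCore.eq_top_two_three'`) is applied to the admissible algebra
`𝔤 = Lie Hg(H)` itself (`commutator_mem_hodgeLie`, `mem_hodgeLieC_of_forall_piece`, `commute_of_mem_hodgeLie`,
`form_apply_add_eq_zero_of_mem_hodgeLie`) and read through `hodgeLieC_eq_spanC`; then through the multiplicity
dictionary of R9 (`finrank_eigenspace_inf_piece_oneZero_eq_eigenMultiplicity`, `…_zeroOne_eq_eigenMultiplicity_conj`,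
`exists_eq_smul_one_add_smul_bettiMapHom`, `bettiMapHom_mul_self`):
* §1 **`UnitaryThetaTwoThree.mem_hodgeLieC_of_commute_of_skew`** (abstract polarizable `ℚ`-Hodge structures of weight
  `1`): `E = ℚ + ℚφ`, `φ² = -d`, `{dim W^{1,0}, dim W^{0,1}} = {2,3}` for `W = ker(φ_ℂ − μ)` ⟹ every `φ_ℂ`-commuting
  `ψ_ℂ`-skew operator lies in `Lie Hg(H) ⊗ ℂ`;
* §2 **`hodgeLieC_twoThree_of_eigenMultiplicity`** (geometric): for `φ ≫ φ = -d` (`d > 0`), `finrank_ℚ End⁰(A) = 2`,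
  eigen-multiplicities `{3,2}` at `± i√d` — so `dim A = 5` — and ANY polarization `ψ` of `H¹(A(ℂ); ℚ)`: every
  `(φ^*)_ℂ`-commuting `ψ_ℂ`-skew operator lies in `Lie Hg(H¹(A)) ⊗ ℂ` (Moonen–Zarhin (2.4) «a simple abelian fivefold
  of Type IV(1) has `k` acting with multiplicities `(1,4)` or `(2,3)`», (2.7) «for `g = 5` we always find
  `Hg(X) = Sp_D(V,φ)`», here `= U_k(V,ψ)`, in Lie form, for ALL members with `End⁰ = k`); and the convenience form
  **`hodgeLieC_twoThree_of_dim_eq_five`** (`dim A = 5` and multiplicity `2` or `3` at `i√d`).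
The `(4,1)` fivefolds are the `(m,1)` adapter's `hodgeLieC_typeOne_of_eigenMultiplicity_eq_one`.

## References
* [MoonenZarhin1999LowDim] B. Moonen, Yu. Zarhin, Math. Ann. 315 (1999) = arXiv:math/9901113, §1 (1.8), §2 (2.3)–(2.4),
  Thm. (2.7).
* [Ribet1983] K. A. Ribet, Amer. J. Math. 105 (1983), Thm. 0 and Thm. 3.
* [Deligne1982HodgeCycles] P. Deligne, LNM 900 (1982), I §3 Prop. 3.4.
* [Gordon1997] B. B. Gordon, arXiv:alg-geom/9709030, Thm. 6.3 (3), §6 pp. 18–19.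
-/

noncomputable section

open scoped TensorProduct
open CategoryTheory Module


namespace Literature.AlgebraicGeometry.Motives.HodgeStructure

universe u

variable {V : Type u} [AddCommGroup V] [Module ℚ V] {n : ℤ}

/-! ## §1 The abstract socket at `(2,3)` -/

/-- **Ribet type `(2,3)`: every `φ_ℂ`-commuting `ψ_ℂ`-skew operator lies in `Lie Hg(H) ⊗ ℂ`** (MZ99 (2.4)/(2.7) «`Hg(X) =
U_k(V, ψ)`» for a simple fivefold of Type IV(1) with multiplicities `(2,3)`; Ribet Thm. 3 at the coprime pair `(2,3)`) —
`UnitaryThetaTwoThree.mem_spanC_of_commute_of_skew` for `𝔤 = Lie Hg(H)`: the socket's `hU`, discharged.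
[cite: MoonenZarhin1999LowDim, §2 (2.4) and Thm. (2.7)] [cite: Ribet1983, Thm. 3] [cite: Deligne1982HodgeCycles, I §3 Prop. 3.4] -/
theorem UnitaryThetaTwoThree.mem_hodgeLieC_of_commute_of_skew [Module.Finite ℚ V] [HodgeTensorFacts.{u, u}]
    (H : HodgeStructure V n) (hn : n = 1) (heff : H.IsEffective) (ψ : H.Polarization) {φ : Module.End ℚ V}
    (hφE : φ ∈ H.endAlg) {d : ℚ} (hd : 0 < d) (hφ2 : φ * φ = -(d • 1))
    (hE : ∀ a ∈ H.endAlg, ∃ x y : ℚ, a = x • 1 + y • φ) {μ : ℂ} (hμ : μ ^ 2 = -(d : ℂ))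
    (h23 : (Module.finrank ℂ ↥(Module.End.eigenspace (φ.baseChange ℂ) μ ⊓ H.piece 1 0) = 2 ∧
        Module.finrank ℂ ↥(Module.End.eigenspace (φ.baseChange ℂ) μ ⊓ H.piece 0 1) = 3) ∨
      (Module.finrank ℂ ↥(Module.End.eigenspace (φ.baseChange ℂ) μ ⊓ H.piece 1 0) = 3 ∧
        Module.finrank ℂ ↥(Module.End.eigenspace (φ.baseChange ℂ) μ ⊓ H.piece 0 1) = 2)) :
    ∀ Y : Module.End ℂ (ℂ ⊗[ℚ] V), Y * φ.baseChange ℂ = φ.baseChange ℂ * Y →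
      (∀ x y, ψ.form.baseChange ℂ (Y x) y + ψ.form.baseChange ℂ x (Y y) = 0) → Y ∈ H.hodgeLieC := fun Y hYφ hYskew => by
  obtain ⟨Θ, hΘ⟩ := exists_hodgeTheta H
  have hΘ𝔤 : Θ ∈ spanC H.hodgeLie := (hodgeLieC_eq_spanC H) ▸ H.mem_hodgeLieC_of_forall_piece hΘ
  rw [hodgeLieC_eq_spanC]
  exact UnitaryThetaTwoThree.mem_spanC_of_commute_of_skew H hn heff ψ hφE hd hφ2 hE hμ h23 H.hodgeLie
    (fun X hX X' hX' => H.commutator_mem_hodgeLie hX hX') hΘ hΘ𝔤 (fun X hX a => H.commute_of_mem_hodgeLie hX a)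
    (fun X hX => form_apply_add_eq_zero_of_mem_hodgeLie ψ hX) hYφ hYskew

end Literature.AlgebraicGeometry.Motives.HodgeStructure


namespace Literature.AlgebraicGeometry.HodgeTheory

open Literature.AlgebraicTopology.SingularHomology
open Literature.AlgebraicGeometry.Motives (IsSmoothProjective AbelianVariety bettiCohomology
  ofRatClassBaseChange ofRatClassBaseChange_tmul HodgeTensorFacts hodgeTensorFacts_holds)
open Literature.Barriers.HodgeConjecture
open Literature.AlgebraicGeometry.Motives.HodgeStructure
open Literature.AlgebraicGeometry.ComplexMultiplication (bettiRep_of)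

variable {A : AbelianVariety ℂ}

/-! ## §2 `hU` for Ribet type `(2,3)` — the factor input of TABLE X row 17 -/

/-- **`hU` for an abelian variety of Ribet type `(2,3)`** (`φ ≫ φ = -d`, `d > 0`, `finrank_ℚ End⁰(A) = 2`, eigen-multiplicities
`{3,2}` at `i√d`, `-i√d` — so `dim A = 5` —, ANY polarization `ψ` of `H¹(A(ℂ); ℚ)`): every `(φ^*)_ℂ`-commuting `ψ_ℂ`-skew
operator lies in `Lie Hg(H¹(A)) ⊗ ℂ`, i.e. `Hg(A) = U_k(H¹(A;ℚ), ψ)` in Lie form (§1 at `μ = i√d`, through the multiplicity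
dictionary of R9).  For EVERY member with `End⁰ = k`: `Hg = U_k` is forced arithmetically at the coprime pair `(2,3)`.
[cite: MoonenZarhin1999LowDim, §2 (2.4) and Thm. (2.7)] [cite: Ribet1983, Thm. 3] [cite: Deligne1982HodgeCycles, I §3 Prop. 3.4] -/
theorem hodgeLieC_twoThree_of_eigenMultiplicity [HodgeTensorFacts.{0, 0}] (φ : A ⟶ A) {d : ℕ} (hd : 0 < d)
    (hφ : φ ≫ φ = -(d • 𝟙 A)) (hE2 : Module.finrank ℚ A.endAlgebra = 2)
    (h23 : (eigenMultiplicity A φ (Complex.I * (Real.sqrt d : ℂ)) = 3 ∧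
        eigenMultiplicity A φ (-(Complex.I * (Real.sqrt d : ℂ))) = 2) ∨
      (eigenMultiplicity A φ (Complex.I * (Real.sqrt d : ℂ)) = 2 ∧
        eigenMultiplicity A φ (-(Complex.I * (Real.sqrt d : ℂ))) = 3))
    (hHD : exists_isReal_hodgeModel) (hI : hodgePQ_independent_of_hodgeModel)
    (ψ : (BettiUniverse.hodge hHD (AbelianVariety.isSmoothProjective_holds (A := A)) 1).Polarization) :
    ∀ Y : Module.End ℂ (ℂ ⊗[ℚ] bettiCohomology A.X 1),
      Y * ((bettiCohomology.map φ.hom.hom.hom 1).hom).baseChange ℂ =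
          ((bettiCohomology.map φ.hom.hom.hom 1).hom).baseChange ℂ * Y →
        (∀ x y, ψ.form.baseChange ℂ (Y x) y + ψ.form.baseChange ℂ x (Y y) = 0) →
          Y ∈ (BettiUniverse.hodge hHD (AbelianVariety.isSmoothProjective_holds (A := A)) 1).hodgeLieC := by
  classical
  haveI : Module.Finite ℚ (bettiCohomology A.X 1) := finite_bettiCohomology_one A
  have heff := BettiUniverse.hodge_isEffective hHD (AbelianVariety.isSmoothProjective_holds (A := A)) 1
  set φQ : Module.End ℚ (bettiCohomology A.X 1) := (bettiCohomology.map φ.hom.hom.hom 1).hom with hφQ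
  have hφE : φQ ∈ (BettiUniverse.hodge hHD (AbelianVariety.isSmoothProjective_holds (A := A)) 1).endAlg := by
    have h := unop_bettiRep_mem_endAlg hHD hI (AbelianVariety.endAlgebra.of A φ)
    rwa [bettiRep_of, MulOpposite.unop_op] at h
  have hφ2 : φQ * φQ = -((d : ℚ) • 1) := bettiMapHom_mul_self hφ
  have hdQ : (0 : ℚ) < d := Nat.cast_pos.2 hd
  -- `dim A = 5 > 0`
  have hsum := eigenMultiplicity_add_eigenMultiplicity_neg_eq_dim A φ hd hφ
  have hA : 0 < A.dim := by rcases h23 with ⟨h3, h2⟩ | ⟨h2, h3⟩ <;> omega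
  have hE := exists_eq_smul_one_add_smul_bettiMapHom hHD hI hd hφ hE2 hA
  -- the eigenvalue `μ = i√d`
  have hμ₀ : (Complex.I * (Real.sqrt d : ℂ)) ^ 2 = -((d : ℚ) : ℂ) := by
    rw [mul_pow, Complex.I_sq, ← Complex.ofReal_pow, Real.sq_sqrt (Nat.cast_nonneg d), Complex.ofReal_natCast,
      Rat.cast_natCast, neg_one_mul]
  have hconj₀ : starRingEnd ℂ (Complex.I * (Real.sqrt d : ℂ)) = -(Complex.I * (Real.sqrt d : ℂ)) := by simp
  have h10 : Module.finrank ℂ ↥(Module.End.eigenspace (φQ.baseChange ℂ) (Complex.I * (Real.sqrt d : ℂ)) ⊓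
      (BettiUniverse.hodge hHD (AbelianVariety.isSmoothProjective_holds (A := A)) 1).piece 1 0) =
      eigenMultiplicity A φ (Complex.I * (Real.sqrt d : ℂ)) := by
    rw [hφQ, finrank_eigenspace_inf_piece_oneZero_eq_eigenMultiplicity hHD hI φ]
  have h01 : Module.finrank ℂ ↥(Module.End.eigenspace (φQ.baseChange ℂ) (Complex.I * (Real.sqrt d : ℂ)) ⊓
      (BettiUniverse.hodge hHD (AbelianVariety.isSmoothProjective_holds (A := A)) 1).piece 0 1) =
      eigenMultiplicity A φ (-(Complex.I * (Real.sqrt d : ℂ))) := by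
    rw [hφQ, finrank_eigenspace_inf_piece_zeroOne_eq_eigenMultiplicity_conj hHD hI φ, hconj₀]
  have h23' : (Module.finrank ℂ ↥(Module.End.eigenspace (φQ.baseChange ℂ) (Complex.I * (Real.sqrt d : ℂ)) ⊓
        (BettiUniverse.hodge hHD (AbelianVariety.isSmoothProjective_holds (A := A)) 1).piece 1 0) = 2 ∧
      Module.finrank ℂ ↥(Module.End.eigenspace (φQ.baseChange ℂ) (Complex.I * (Real.sqrt d : ℂ)) ⊓
        (BettiUniverse.hodge hHD (AbelianVariety.isSmoothProjective_holds (A := A)) 1).piece 0 1) = 3) ∨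
      (Module.finrank ℂ ↥(Module.End.eigenspace (φQ.baseChange ℂ) (Complex.I * (Real.sqrt d : ℂ)) ⊓
        (BettiUniverse.hodge hHD (AbelianVariety.isSmoothProjective_holds (A := A)) 1).piece 1 0) = 3 ∧
      Module.finrank ℂ ↥(Module.End.eigenspace (φQ.baseChange ℂ) (Complex.I * (Real.sqrt d : ℂ)) ⊓
        (BettiUniverse.hodge hHD (AbelianVariety.isSmoothProjective_holds (A := A)) 1).piece 0 1) = 2) := by
    rw [h10, h01]
    rcases h23 with ⟨h3, h2⟩ | ⟨h2, h3⟩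
    · exact Or.inr ⟨h3, h2⟩
    · exact Or.inl ⟨h2, h3⟩
  exact UnitaryThetaTwoThree.mem_hodgeLieC_of_commute_of_skew
    (BettiUniverse.hodge hHD (AbelianVariety.isSmoothProjective_holds (A := A)) 1) Nat.cast_one heff ψ hφE hdQ hφ2 hE
    hμ₀ h23'

/-- **Convenience form for a FIVEFOLD**: `dim A = 5`, `φ ≫ φ = -d` (`d > 0`), `finrank_ℚ End⁰(A) = 2` and multiplicity `2`
or `3` at `i√d` (the other multiplicity is then `3` or `2`, `eigenMultiplicity_add_eigenMultiplicity_neg_eq_dim`): every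
`(φ^*)_ℂ`-commuting `ψ_ℂ`-skew operator of `H¹(A(ℂ); ℂ)` lies in `Lie Hg(H¹(A)) ⊗ ℂ` — the shape in which TABLE X row 17
(`E_k × Y₅^{(3,2)}`, `Y₅` simple with `End⁰ = k`) quotes its factor.  (MZ99 (2.4): the Type IV(1) fivefolds not covered here,
multiplicities `(1,4)`, are `hodgeLieC_typeOne_of_eigenMultiplicity_eq_one`.)
[cite: MoonenZarhin1999LowDim, §2 (2.4) and Thm. (2.7)] [cite: Ribet1983, Thm. 3] -/
theorem hodgeLieC_twoThree_of_dim_eq_five [HodgeTensorFacts.{0, 0}] (hA5 : A.dim = 5) (φ : A ⟶ A) {d : ℕ} (hd : 0 < d)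
    (hφ : φ ≫ φ = -(d • 𝟙 A)) (hE2 : Module.finrank ℚ A.endAlgebra = 2)
    (h23 : eigenMultiplicity A φ (Complex.I * (Real.sqrt d : ℂ)) = 2 ∨
      eigenMultiplicity A φ (Complex.I * (Real.sqrt d : ℂ)) = 3)
    (hHD : exists_isReal_hodgeModel) (hI : hodgePQ_independent_of_hodgeModel)
    (ψ : (BettiUniverse.hodge hHD (AbelianVariety.isSmoothProjective_holds (A := A)) 1).Polarization) :
    ∀ Y : Module.End ℂ (ℂ ⊗[ℚ] bettiCohomology A.X 1),
      Y * ((bettiCohomology.map φ.hom.hom.hom 1).hom).baseChange ℂ =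
          ((bettiCohomology.map φ.hom.hom.hom 1).hom).baseChange ℂ * Y →
        (∀ x y, ψ.form.baseChange ℂ (Y x) y + ψ.form.baseChange ℂ x (Y y) = 0) →
          Y ∈ (BettiUniverse.hodge hHD (AbelianVariety.isSmoothProjective_holds (A := A)) 1).hodgeLieC := by
  have hsum := eigenMultiplicity_add_eigenMultiplicity_neg_eq_dim A φ hd hφ
  refine hodgeLieC_twoThree_of_eigenMultiplicity φ hd hφ hE2 ?_ hHD hI ψ
  rcases h23 with h2 | h3
  · exact Or.inr ⟨h2, by omega⟩
  · exact Or.inl ⟨h3, by omega⟩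

end Literature.AlgebraicGeometry.HodgeTheory

end
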